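import Summits.Ventures.PercRepro.ProfilePointedCircuitClassesStarSharpD0W
import Summits.Ventures.PercRepro.ProfilePointedCircuitClassesStarSharpD0X

/-!
# PercRepro — CASE D0 OF `StarNineSharp`, PART Y: THE COUNT, AND THE SET IDENTITIES OF THE BRIDGE
(p5, gen 55; `proofs/P5-GM1.md` §82 (d))

`card_le_cset_add_gset` is the pure counting statement behind the `ef`-plane bound: the demands are indexed by their
opposite vertices `Dt ⊆ T` (`|T| = 3`); every `t ∈ Dt` owns a target — `t ∈ Cset`, or a pair `(t, w̃) ∈ G`, or a double
`(x, w̃) ∈ G` for every `w̃ ∈ W` (`|W| = 2`) — and three demands put all of `T` into `Cset`; then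
`|Dt| ≤ |Cset| + |G|`.  Proof: the demands with `t ∈ Cset` are at most `|Cset|`; the others are at most two, and either
some double gives two elements of `G` or their singles inject into `G` by the first component.
The rest of the file: the set identities on `X = {x, y, z, w, w′}` used by the bridge (part Z), proved in an empty
context.
-/

open scoped Matroid

namespace PercRepro.Cogirth

open Finset ThmH Skew Shadow Profile

open Classical

variable {α : Type} [DecidableEq α] {N : Matroid α} [N.Finite]

section StarSharpD0Y

/-- **THE COUNT**: `|Dt| ≤ |Cset| + |G|` from the target facts H1 and the three-demand fact H2. -/
theorem card_le_cset_add_gset {T W Cset Dt : Finset α} {G : Finset (α × α)} (hDT : Dt ⊆ T) (hT3 : T.card = 3)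
    (hW2 : W.card = 2)
    (H1 : ∀ t ∈ Dt, t ∈ Cset ∨ (∃ w, (t, w) ∈ G) ∨ (∃ x ∈ T, ∀ w ∈ W, (x, w) ∈ G))
    (H2 : Dt.card = 3 → T ⊆ Cset) : Dt.card ≤ Cset.card + G.card := by
  have hAB := card_filter_add_card_filter_not (s := Dt) (fun t => t ∈ Cset)
  have hAC : (Dt.filter (fun t => t ∈ Cset)).card ≤ Cset.card :=
    card_le_card (fun t ht => (mem_filter.1 ht).2)
  have hBG : (Dt.filter (fun t => ¬ t ∈ Cset)).card ≤ G.card := by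
    by_cases h3 : Dt.card = 3
    · have hTC := H2 h3
      have hB : Dt.filter (fun t => ¬ t ∈ Cset) = ∅ := by
        rw [filter_eq_empty_iff]
        intro t ht hnc
        exact hnc (hTC (hDT ht))
      rw [hB, card_empty]
      exact Nat.zero_le _
    · have hDle : Dt.card ≤ 2 := by
        have := card_le_card hDT
        rw [hT3] at this
        omega
      have hBle : (Dt.filter (fun t => ¬ t ∈ Cset)).card ≤ 2 := (card_filter_le _ _).trans hDle
      by_cases hdouble : ∃ x ∈ T, ∀ w ∈ W, (x, w) ∈ G
      · obtain ⟨x, -, hx⟩ := hdouble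
        obtain ⟨w, w', hww, hWeq⟩ := card_eq_two.1 hW2
        have h1 : (x, w) ∈ G := hx w (by rw [hWeq]; exact mem_insert_self _ _)
        have h2 : (x, w') ∈ G := hx w' (by rw [hWeq]; exact mem_insert_of_mem (mem_singleton_self _))
        have hsub : ({(x, w), (x, w')} : Finset (α × α)) ⊆ G := by
          intro p hp
          simp only [mem_insert, mem_singleton] at hp
          rcases hp with rfl | rfl
          · exact h1
          · exact h2
        have := card_le_card hsub
        rw [card_pair (by intro h'; exact hww (Prod.mk.inj h').2)] at this
        omega
      · push Not at hdouble
        have hsingle : ∀ t ∈ Dt.filter (fun t => ¬ t ∈ Cset), ∃ w, (t, w) ∈ G := by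
          intro t ht
          have ht' := mem_filter.1 ht
          rcases H1 t ht'.1 with h | h | h
          · exact absurd h ht'.2
          · exact h
          · obtain ⟨x, hxT, hx⟩ := h
            obtain ⟨w, hw, hnot⟩ := hdouble x hxT
            exact absurd (hx w hw) hnot
        apply card_le_card_of_injOn (fun t => (t, if h : ∃ w, (t, w) ∈ G then h.choose else t))
        · intro t ht
          have hs := hsingle t ht
          simp only [mem_coe]
          rw [dif_pos hs]
          exact hs.choose_spec
        · intro t₁ _ t₂ _ heq
          exact (Prod.mk.inj heq).1
  omega

/-! ### Set identities on `{x, y, z, w, w'}` (empty context) -/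

/-- A 2-subset of `{x, y, z}` is one of the three pairs. -/
theorem pair_of_subset_triple {x y z : α} {π : Finset α} (hπ : π ⊆ {x, y, z}) (hπ2 : π.card = 2) :
    π = {x, y} ∨ π = {x, z} ∨ π = {y, z} := by
  obtain ⟨p, q, hpq, rfl⟩ := card_eq_two.1 hπ2
  have hp : p ∈ ({x, y, z} : Finset α) := hπ (mem_insert_self _ _)
  have hq : q ∈ ({x, y, z} : Finset α) := hπ (mem_insert_of_mem (mem_singleton_self _))
  simp only [mem_insert, mem_singleton] at hp hq
  rcases hp with rfl | rfl | rfl <;> rcases hq with rfl | rfl | rfl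
  · exact absurd rfl hpq
  · exact Or.inl rfl
  · exact Or.inr (Or.inl rfl)
  · exact Or.inl (pair_comm' _ _)
  · exact absurd rfl hpq
  · exact Or.inr (Or.inr rfl)
  · exact Or.inr (Or.inl (pair_comm' _ _))
  · exact Or.inr (Or.inr (pair_comm' _ _))
  · exact absurd rfl hpq

/-- `{x, y, z, w, w'} \ {x, y} = {z, w, w'}`. -/
theorem quint_sdiff_xy {x y z w w' : α} (hxz : x ≠ z) (hxw : x ≠ w) (hxw' : x ≠ w') (hyz : y ≠ z) (hyw : y ≠ w)
    (hyw' : y ≠ w') : ({x, y, z, w, w'} : Finset α) \ {x, y} = {z, w, w'} := by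
  ext a; simp only [mem_sdiff, mem_insert, mem_singleton]
  constructor
  · rintro ⟨h1, h2⟩; tauto
  · rintro (rfl | rfl | rfl)
    · exact ⟨by tauto, by rintro (rfl | rfl) <;> simp_all⟩
    · exact ⟨by tauto, by rintro (rfl | rfl) <;> simp_all⟩
    · exact ⟨by tauto, by rintro (rfl | rfl) <;> simp_all⟩

/-- `{x, y, z, w, w'} \ {z, w} = {x, y, w'}`. -/
theorem quint_sdiff_zw {x y z w w' : α} (hxz : x ≠ z) (hxw : x ≠ w) (hyz : y ≠ z) (hyw : y ≠ w) (hzw' : z ≠ w')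
    (hww : w ≠ w') : ({x, y, z, w, w'} : Finset α) \ {z, w} = {x, y, w'} := by
  ext a; simp only [mem_sdiff, mem_insert, mem_singleton]
  constructor
  · rintro ⟨h1, h2⟩; tauto
  · rintro (rfl | rfl | rfl)
    · exact ⟨by tauto, by rintro (rfl | rfl) <;> simp_all⟩
    · exact ⟨by tauto, by rintro (rfl | rfl) <;> simp_all⟩
    · exact ⟨by tauto, by rintro (rfl | rfl) <;> simp_all⟩

/-- `{x, y, z, w, w'}.erase z = {x, y, w, w'}`. -/
theorem quint_erase_z {x y z w w' : α} (hxz : x ≠ z) (hyz : y ≠ z) (hzw : z ≠ w) (hzw' : z ≠ w') :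
    ({x, y, z, w, w'} : Finset α).erase z = {x, y, w, w'} := by
  ext a; simp only [mem_erase, mem_insert, mem_singleton]
  constructor
  · rintro ⟨h1, h2⟩; tauto
  · rintro (rfl | rfl | rfl | rfl)
    · exact ⟨hxz, by tauto⟩
    · exact ⟨hyz, by tauto⟩
    · exact ⟨hzw.symm, by tauto⟩
    · exact ⟨hzw'.symm, by tauto⟩

/-- `{x, y, z, w, w'} = {x, z, y, w, w'}`. -/
theorem quint_swap23 (x y z w w' : α) : ({x, y, z, w, w'} : Finset α) = {x, z, y, w, w'} := by
  ext a; simp only [mem_insert, mem_singleton]; tauto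

/-- `{x, y, z, w, w'} = {y, z, x, w, w'}`. -/
theorem quint_rot (x y z w w' : α) : ({x, y, z, w, w'} : Finset α) = {y, z, x, w, w'} := by
  ext a; simp only [mem_insert, mem_singleton]; tauto

/-- `{x, y, z, w, w'} = {x, y, z, w', w}`. -/
theorem quint_swap45 (x y z w w' : α) : ({x, y, z, w, w'} : Finset α) = {x, y, z, w', w} := by
  ext a; simp only [mem_insert, mem_singleton]; tauto

end StarSharpD0Y

end PercRepro.Cogirth
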